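import Literature.Geometry.Lorentzian.Basic
import Literature.Analysis.FluidPDE.PoincareBall

/-!
# Route ClusterCompleteness — crux `AdiabaticMultiKerrILED`, line `Sketch`: constant at infinity,
# the dyadic balls

Helper file for the crux `stmt-FinalStateConjecture-14310`
(`Summit.FinalStateConjecture.FinalStateConjecture.Theses.ClusterCompleteness.AdiabaticMultiKerrILED`),
stub `stub_constantAtInfinity` of line `Sketch`. At the dyadic scale `u` the exterior shell
`{10u ≤ ‖y‖ ≤ 20u}` of `ℝ³` is covered by the six balls `B(40u(±eᵢ), 39u)`, each inside the thick
shell `{u < ‖y‖ ≤ 2^7 u}`; two of them along orthogonal axes contain the ball `B(20u(v + w), 10u)`,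
and `B(40u v, 10u) ⊆ B(40u v, 39u) ∩ B(80u v, 78u)` links consecutive scales. For a `C¹` function
`f` on `ℝ³` the Poincaré inequality on balls
(`Literature.Analysis.FluidPDE.PoincareBall.lintegral_ball_sub_average_sq_le`) and Jensen then
bound `u ‖⨍_{B₁} f − ⨍_{B₂} f‖²` for two such balls by a universal multiple of the Dirichlet
energy of the thick shells (namespace `….Sketch.ConstantAtInfinity`):

* `enorm_const_sub_setAverage_sq_le`, `enorm_setAverage_sub_setAverage_sq_le` — Jensen;
* `ball_subset_shell`, `ball_subset_ball_double`, `ball_subset_ball_orth`,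
  `exists_mem_ball_of_mem_shell` — the geometry of the six balls;
* `dev_ball_le`, `mean_sub_mean_le`, `setLIntegral_sq_div_le` — Poincaré on one ball, the
  comparison of two means, and the weighted `L²` bound on one ball of the cover.

Standard real analysis (Evans, *PDE*, §5.8.1 for Poincaré). [folklore]
-/

noncomputable section

-- the doubled `FinalStateConjecture.FinalStateConjecture` path component trips dupNamespace
set_option linter.dupNamespace false

open scoped ENNReal NNReal Topology InnerProductSpace
open MeasureTheory Set Metric Filter Literature.Geometry.Lorentzian

namespace Summit.FinalStateConjecture.FinalStateConjecture.Cruxes.AdiabaticMultiKerrILED.Sketch.ConstantAtInfinity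

/-! ### Means over sets: Jensen -/

/-- **A constant against a mean.** For `f` integrable on a set `S` of finite positive measure and
a constant `c₀`: `‖c₀ − ⨍_S f‖ₑ² ≤ μ(S)⁻¹ ∫_S ‖c₀ − f‖ₑ²` (the mean of `c₀ − f` over `S` is
`c₀ − ⨍_S f`; then Cauchy–Schwarz). [folklore] -/
theorem enorm_const_sub_setAverage_sq_le {f : E3 → ℝ} {S : Set E3}
    (hS0 : volume S ≠ 0) (hStop : volume S ≠ ⊤) (hint : IntegrableOn f S volume) (c₀ : ℝ) :
    ‖c₀ - ⨍ y in S, f y‖ₑ ^ 2 ≤ (volume S)⁻¹ * ∫⁻ y in S, ‖c₀ - f y‖ₑ ^ 2 := by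
  -- adapted from `Literature.Analysis.FluidPDE.PoincareBall.enorm_sub_setAverage_sq_le`
  have hc : volume.real S = (volume S).toReal := measureReal_def _ _
  have hcpos : 0 < volume.real S := by rw [hc]; exact ENNReal.toReal_pos hS0 hStop
  have hconst : IntegrableOn (fun _ : E3 => c₀) S volume := integrableOn_const hStop
  have hmean : c₀ - ⨍ y in S, f y = (volume.real S)⁻¹ • ∫ y in S, (c₀ - f y) := by
    rw [integral_sub hconst hint, setIntegral_const, setAverage_eq, smul_sub,
      smul_smul, inv_mul_cancel₀ hcpos.ne', one_smul]
  have hnorm : ‖c₀ - ⨍ y in S, f y‖ₑ ≤ (volume S)⁻¹ * ∫⁻ y in S, ‖c₀ - f y‖ₑ := by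
    rw [hmean, enorm_smul]
    have hci : ‖(volume.real S)⁻¹‖ₑ = (volume S)⁻¹ := by
      rw [Real.enorm_eq_ofReal (inv_nonneg.2 hcpos.le), ENNReal.ofReal_inv_of_pos hcpos, hc,
        ENNReal.ofReal_toReal hStop]
    rw [hci]
    gcongr
    exact enorm_integral_le_lintegral_enorm _
  have hg : AEMeasurable (fun y => ‖c₀ - f y‖ₑ) (volume.restrict S) :=
    (aestronglyMeasurable_const.sub hint.aestronglyMeasurable).enorm
  have hcs := Literature.Analysis.FluidPDE.PoincareBall.sq_lintegral_le_measure_mul_lintegral_sq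
    (volume.restrict S) hg
  rw [Measure.restrict_apply_univ] at hcs
  calc ‖c₀ - ⨍ y in S, f y‖ₑ ^ 2 ≤ ((volume S)⁻¹ * ∫⁻ y in S, ‖c₀ - f y‖ₑ) ^ 2 :=
        pow_le_pow_left' hnorm 2
    _ ≤ (volume S)⁻¹ ^ 2 * (volume S * ∫⁻ y in S, ‖c₀ - f y‖ₑ ^ 2) := by
        rw [mul_pow]; gcongr
    _ = (volume S)⁻¹ * ∫⁻ y in S, ‖c₀ - f y‖ₑ ^ 2 := by
        rw [sq, mul_assoc, ← mul_assoc (volume S)⁻¹ (volume S), ENNReal.inv_mul_cancel hS0 hStop,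
          one_mul]

/-- **Two means through a common subset.** If `I ⊆ S₁ ∩ S₂` has finite positive measure and `f`
is integrable on `S₁` and on `S₂`, then
`‖⨍_{S₁} f − ⨍_{S₂} f‖ₑ² ≤ 2 μ(I)⁻¹ (∫_{S₁} ‖f − ⨍_{S₁} f‖ₑ² + ∫_{S₂} ‖f − ⨍_{S₂} f‖ₑ²)`
(both means are compared with `⨍_I f` by the previous lemma). [folklore] -/
theorem enorm_setAverage_sub_setAverage_sq_le {f : E3 → ℝ} {S₁ S₂ I : Set E3}
    (hI0 : volume I ≠ 0) (hItop : volume I ≠ ⊤) (h₁ : I ⊆ S₁) (h₂ : I ⊆ S₂)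
    (hint₁ : IntegrableOn f S₁ volume) :
    ‖(⨍ y in S₁, f y) - ⨍ y in S₂, f y‖ₑ ^ 2 ≤
      2 * (volume I)⁻¹ * ((∫⁻ y in S₁, ‖f y - ⨍ z in S₁, f z‖ₑ ^ 2) +
        ∫⁻ y in S₂, ‖f y - ⨍ z in S₂, f z‖ₑ ^ 2) := by
  set a₁ : ℝ := ⨍ y in S₁, f y with ha₁
  set a₂ : ℝ := ⨍ y in S₂, f y with ha₂
  set aI : ℝ := ⨍ y in I, f y with haI
  change ‖a₁ - a₂‖ₑ ^ 2 ≤ 2 * (volume I)⁻¹ *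
    ((∫⁻ y in S₁, ‖f y - a₁‖ₑ ^ 2) + ∫⁻ y in S₂, ‖f y - a₂‖ₑ ^ 2)
  have hintI : IntegrableOn f I volume := hint₁.mono_set h₁
  have hJ : ∀ {S : Set E3} (a : ℝ), I ⊆ S →
      ‖a - aI‖ₑ ^ 2 ≤ (volume I)⁻¹ * ∫⁻ y in S, ‖f y - a‖ₑ ^ 2 := by
    intro S a hS
    calc ‖a - aI‖ₑ ^ 2 ≤ (volume I)⁻¹ * ∫⁻ y in I, ‖a - f y‖ₑ ^ 2 :=
          enorm_const_sub_setAverage_sq_le hI0 hItop hintI a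
      _ = (volume I)⁻¹ * ∫⁻ y in I, ‖f y - a‖ₑ ^ 2 := by
          congr 1
          exact lintegral_congr fun y => by rw [← enorm_neg, neg_sub]
      _ ≤ (volume I)⁻¹ * ∫⁻ y in S, ‖f y - a‖ₑ ^ 2 :=
          mul_le_mul_right (lintegral_mono_set hS) _
  have htri : ‖a₁ - a₂‖ₑ ≤ ‖a₁ - aI‖ₑ + ‖a₂ - aI‖ₑ := by
    calc ‖a₁ - a₂‖ₑ = ‖(a₁ - aI) + (aI - a₂)‖ₑ := by rw [sub_add_sub_cancel]
      _ ≤ ‖a₁ - aI‖ₑ + ‖aI - a₂‖ₑ := enorm_add_le _ _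
      _ = ‖a₁ - aI‖ₑ + ‖a₂ - aI‖ₑ := by rw [← enorm_neg (aI - a₂), neg_sub]
  calc ‖a₁ - a₂‖ₑ ^ 2 ≤ (‖a₁ - aI‖ₑ + ‖a₂ - aI‖ₑ) ^ 2 := pow_le_pow_left' htri 2
    _ ≤ 2 * ‖a₁ - aI‖ₑ ^ 2 + 2 * ‖a₂ - aI‖ₑ ^ 2 :=
        Literature.Analysis.FluidPDE.PoincareBall.add_sq_le_two_mul_sq_add _ _
    _ ≤ 2 * ((volume I)⁻¹ * ∫⁻ y in S₁, ‖f y - a₁‖ₑ ^ 2) +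
          2 * ((volume I)⁻¹ * ∫⁻ y in S₂, ‖f y - a₂‖ₑ ^ 2) :=
        add_le_add (mul_le_mul_right (hJ a₁ h₁) _) (mul_le_mul_right (hJ a₂ h₂) _)
    _ = 2 * (volume I)⁻¹ *
          ((∫⁻ y in S₁, ‖f y - a₁‖ₑ ^ 2) + ∫⁻ y in S₂, ‖f y - a₂‖ₑ ^ 2) := by ring

/-! ### Geometry of the six balls `B(40u(±eᵢ), 39u)` at one dyadic scale -/

/-- The ball `B(40u v, 39u)`, `‖v‖ = 1`, lies in the thick shell `{u < ‖y‖ ≤ 2^7 u}`. [folklore] -/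
theorem ball_subset_shell {u : ℝ} (hu : 0 < u) {v : E3} (hv : ‖v‖ = 1) :
    ball ((40 * u) • v) (39 * u) ⊆ {y : E3 | u < ‖y‖ ∧ ‖y‖ ≤ u * 2 ^ 7} := by
  intro y hy
  rw [mem_ball, dist_eq_norm] at hy
  have hc : ‖(40 * u) • v‖ = 40 * u := by
    rw [norm_smul, hv, mul_one, Real.norm_eq_abs, abs_of_pos (by positivity)]
  have h1 := norm_sub_norm_le ((40 * u) • v) y
  have h2 := norm_sub_norm_le y ((40 * u) • v)
  rw [norm_sub_rev] at h1
  rw [hc] at h1 h2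
  constructor
  · linarith
  · linarith

/-- Same direction, consecutive scales: `B(40u v, 10u) ⊆ B(40(2u) v, 39(2u))`. [folklore] -/
theorem ball_subset_ball_double {u : ℝ} (hu : 0 < u) {v : E3} (hv : ‖v‖ = 1) :
    ball ((40 * u) • v) (10 * u) ⊆ ball ((40 * (2 * u)) • v) (39 * (2 * u)) := by
  intro y hy
  rw [mem_ball, dist_eq_norm] at hy ⊢
  have hc : ‖(40 * u) • v - (40 * (2 * u)) • v‖ = 40 * u := by
    rw [← sub_smul, norm_smul, hv, mul_one, Real.norm_eq_abs, show 40 * u - 40 * (2 * u) = -(40 * u) by ring,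
      abs_neg, abs_of_pos (by positivity)]
  calc ‖y - (40 * (2 * u)) • v‖ = ‖(y - (40 * u) • v) + ((40 * u) • v - (40 * (2 * u)) • v)‖ := by
        rw [sub_add_sub_cancel]
    _ ≤ ‖y - (40 * u) • v‖ + ‖(40 * u) • v - (40 * (2 * u)) • v‖ := norm_add_le _ _
    _ < 10 * u + 40 * u := by rw [hc]; linarith
    _ ≤ 39 * (2 * u) := by linarith

/-- Orthogonal directions, same scale: `B(20u(v + w), 10u) ⊆ B(40u v, 39u)` for orthogonal unit
vectors `v, w` (`‖w − v‖ = √2 < 1.45`). [folklore] -/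
theorem ball_subset_ball_orth {u : ℝ} (hu : 0 < u) {v w : E3} (hv : ‖v‖ = 1) (hw : ‖w‖ = 1)
    (hvw : ⟪v, w⟫_ℝ = 0) :
    ball ((20 * u) • (v + w)) (10 * u) ⊆ ball ((40 * u) • v) (39 * u) := by
  intro y hy
  rw [mem_ball, dist_eq_norm] at hy ⊢
  have hwv : ‖w - v‖ < 29 / 20 := by
    have h2 : ‖w - v‖ ^ 2 = 2 := by
      rw [norm_sub_sq_real, hw, hv, real_inner_comm, hvw]; norm_num
    refine lt_of_pow_lt_pow_left₀ 2 (by norm_num) ?_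
    rw [h2]; norm_num
  have hc : ‖(20 * u) • (v + w) - (40 * u) • v‖ = 20 * u * ‖w - v‖ := by
    rw [show (20 * u) • (v + w) - (40 * u) • v = (20 * u) • (w - v) by module, norm_smul,
      Real.norm_eq_abs, abs_of_pos (by positivity)]
  calc ‖y - (40 * u) • v‖ = ‖(y - (20 * u) • (v + w)) + ((20 * u) • (v + w) - (40 * u) • v)‖ := by
        rw [sub_add_sub_cancel]
    _ ≤ ‖y - (20 * u) • (v + w)‖ + ‖(20 * u) • (v + w) - (40 * u) • v‖ := norm_add_le _ _
    _ < 10 * u + 20 * u * (29 / 20) := by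
        rw [hc]
        exact add_lt_add hy (mul_lt_mul_of_pos_left hwv (by positivity))
    _ = 39 * u := by ring

/-- **The six balls cover the shell**: every `y` with `10u ≤ ‖y‖ ≤ 20u` lies in one of the balls
`B(40u σeᵢ, 39u)`, `σ = ±1` (take `i` with `3yᵢ² ≥ ‖y‖²` and `σ = sign yᵢ`). [folklore] -/
theorem exists_mem_ball_of_mem_shell {u : ℝ} (hu : 0 < u) {y : E3} (h1 : 10 * u ≤ ‖y‖)
    (h2 : ‖y‖ ≤ 20 * u) :
    ∃ (i : Fin 3) (b : Bool),
      y ∈ ball ((40 * u) • EuclideanSpace.single i (if b then (1 : ℝ) else -1)) (39 * u) := by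
  -- a coordinate carrying a third of the mass
  obtain ⟨i, -, hi⟩ : ∃ i ∈ (Finset.univ : Finset (Fin 3)), ‖y‖ ^ 2 / 3 ≤ y i ^ 2 := by
    refine Finset.exists_le_of_sum_le Finset.univ_nonempty (le_of_eq ?_)
    rw [Finset.sum_const, Finset.card_univ, Fintype.card_fin, nsmul_eq_mul,
      EuclideanSpace.real_norm_sq_eq]
    ring
  refine ⟨i, decide (0 ≤ y i), ?_⟩
  set σ : ℝ := if decide (0 ≤ y i) then (1 : ℝ) else -1 with hσ
  have hσm : σ * y i = |y i| := by
    by_cases h : 0 ≤ y i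
    · simp [hσ, h, abs_of_nonneg h]
    · simp [hσ, h, abs_of_neg (not_le.1 h)]
  have hσ1 : ‖σ‖ = 1 := by
    by_cases h : 0 ≤ y i <;> simp [hσ, h]
  set m : ℝ := |y i| with hm
  have hm0 : 0 ≤ m := abs_nonneg _
  have hm2 : ‖y‖ ^ 2 ≤ 3 * m ^ 2 := by rw [hm, sq_abs]; linarith
  -- the distance to the centre
  have hdist : ‖y - (40 * u) • EuclideanSpace.single i σ‖ ^ 2 =
      ‖y‖ ^ 2 - 80 * u * m + 1600 * u ^ 2 := by
    rw [norm_sub_sq_real, real_inner_smul_right, EuclideanSpace.inner_single_right, norm_smul,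
      PiLp.norm_single, hσ1, mul_one, Real.norm_eq_abs, abs_of_pos (by positivity)]
    simp only [conj_trivial]
    rw [hσm]
    ring
  have hρ1 : 100 * u ^ 2 ≤ ‖y‖ ^ 2 := by nlinarith
  have hρ2 : ‖y‖ ^ 2 ≤ 400 * u ^ 2 := by nlinarith [norm_nonneg y]
  have hy0 : 0 < ‖y‖ := lt_of_lt_of_le (by positivity) h1
  have p1 : 0 ≤ u ^ 2 * (3 * m ^ 2 - ‖y‖ ^ 2) := mul_nonneg (sq_nonneg u) (by linarith)
  have p2 : 0 ≤ (‖y‖ ^ 2 - 100 * u ^ 2) * (400 * u ^ 2 - ‖y‖ ^ 2) :=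
    mul_nonneg (by linarith) (by linarith)
  have p3 : 0 < u ^ 2 * ‖y‖ ^ 2 := mul_pos (pow_pos hu 2) (pow_pos hy0 2)
  have p4 : 0 < u ^ 2 * u ^ 2 := mul_pos (pow_pos hu 2) (pow_pos hu 2)
  have key : (‖y‖ ^ 2 + 79 * u ^ 2) ^ 2 < (80 * u * m) ^ 2 := by nlinarith [p1, p2, p3, p4]
  have key' : ‖y‖ ^ 2 + 79 * u ^ 2 < 80 * u * m :=
    lt_of_pow_lt_pow_left₀ 2 (by positivity) key
  rw [mem_ball, dist_eq_norm]
  refine lt_of_pow_lt_pow_left₀ 2 (by positivity) ?_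
  rw [hdist]
  nlinarith

/-! ### The truncated function on the dyadic balls -/

/-- **Poincaré on a dyadic ball.** If `f ∈ C¹(ℝ³)` has `Df = Dφ` on `{2R < ‖y‖}` and the ball
`B = B(c, r)` lies in the thick shell `T = {u < ‖y‖ ≤ 2^7 u}`, `2R ≤ u`, then
`∫_B ‖f − ⨍_B f‖ₑ² ≤ 8 · 4r² ∫_T ‖Dφ‖²`
(`Literature.Analysis.FluidPDE.PoincareBall.lintegral_ball_sub_average_sq_le`, `n = 3`). [folklore] -/
theorem dev_ball_le {f φ : E3 → ℝ} {R : ℝ} (hf1 : ContDiff ℝ 1 f)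
    (hDf : ∀ y : E3, 2 * R < ‖y‖ → fderiv ℝ f y = fderiv ℝ φ y) {u : ℝ} (huR : 2 * R ≤ u)
    {c : E3} {r : ℝ} (hr : 0 < r) (hsub : ball c r ⊆ {y : E3 | u < ‖y‖ ∧ ‖y‖ ≤ u * 2 ^ 7}) :
    ∫⁻ y in ball c r, ‖f y - ⨍ z in ball c r, f z‖ₑ ^ 2 ≤
      8 * ENNReal.ofReal (4 * r ^ 2) *
        ∫⁻ y in {y : E3 | u < ‖y‖ ∧ ‖y‖ ≤ u * 2 ^ 7}, ENNReal.ofReal (‖fderiv ℝ φ y‖ ^ 2) := by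
  have hP := Literature.Analysis.FluidPDE.PoincareBall.lintegral_ball_sub_average_sq_le
    (F := ℝ) hf1 c hr
  have h8 : (2 : ℝ≥0∞) ^ Module.finrank ℝ E3 = 8 := by rw [finrank_euclideanSpace_fin]; norm_num
  rw [h8] at hP
  calc ∫⁻ y in ball c r, ‖f y - ⨍ z in ball c r, f z‖ₑ ^ 2
      ≤ 8 * ENNReal.ofReal (4 * r ^ 2) * ∫⁻ y in ball c r, ‖fderiv ℝ f y‖ₑ ^ 2 := hP
    _ = 8 * ENNReal.ofReal (4 * r ^ 2) * ∫⁻ y in ball c r, ENNReal.ofReal (‖fderiv ℝ φ y‖ ^ 2) := by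
        congr 1
        refine setLIntegral_congr_fun measurableSet_ball fun y hy => ?_
        rw [hDf y (lt_of_le_of_lt huR (hsub hy).1), ← ofReal_norm, ENNReal.ofReal_pow (norm_nonneg _)]
    _ ≤ _ := mul_le_mul_right (lintegral_mono_set hsub) _

/-- **Means of two overlapping dyadic balls.** With `f, φ, R` as above, two balls `Bᵢ = B(cᵢ, rᵢ)`
of radii `≤ 78u` inside thick shells `Tᵢ = {uᵢ < ‖y‖ ≤ 2^7 uᵢ}` (`2R ≤ uᵢ`) and containing a
common ball `B(m, 10u)`:
`u ‖⨍_{B₁} f − ⨍_{B₂} f‖ₑ² ≤ K_ov (∫_{T₁} ‖Dφ‖² + ∫_{T₂} ‖Dφ‖²)`,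
`K_ov = 16 · (4 · 78² / 10³) / |B(0,1)|` (Jensen through `B(m, 10u)`, Poincaré on `B₁`, `B₂`, and
`|B(m, 10u)| = 10³ u³ |B(0,1)|`). [folklore] -/
theorem mean_sub_mean_le {f φ : E3 → ℝ} {R : ℝ} (hf1 : ContDiff ℝ 1 f)
    (hDf : ∀ y : E3, 2 * R < ‖y‖ → fderiv ℝ f y = fderiv ℝ φ y)
    {u u₁ u₂ : ℝ} (hu : 0 < u) (hu₁ : 2 * R ≤ u₁) (hu₂ : 2 * R ≤ u₂)
    {c₁ c₂ m : E3} {r₁ r₂ : ℝ} (hr₁ : 0 < r₁) (hr₂ : 0 < r₂) (hr₁u : r₁ ≤ 78 * u)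
    (hr₂u : r₂ ≤ 78 * u)
    (hs₁ : ball c₁ r₁ ⊆ {y : E3 | u₁ < ‖y‖ ∧ ‖y‖ ≤ u₁ * 2 ^ 7})
    (hs₂ : ball c₂ r₂ ⊆ {y : E3 | u₂ < ‖y‖ ∧ ‖y‖ ≤ u₂ * 2 ^ 7})
    (hI₁ : ball m (10 * u) ⊆ ball c₁ r₁) (hI₂ : ball m (10 * u) ⊆ ball c₂ r₂) :
    ENNReal.ofReal u * ‖(⨍ y in ball c₁ r₁, f y) - ⨍ y in ball c₂ r₂, f y‖ₑ ^ 2 ≤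
      16 * ENNReal.ofReal (4 * 78 ^ 2 / 10 ^ 3) * (volume (ball (0 : E3) 1))⁻¹ *
        ((∫⁻ y in {y : E3 | u₁ < ‖y‖ ∧ ‖y‖ ≤ u₁ * 2 ^ 7}, ENNReal.ofReal (‖fderiv ℝ φ y‖ ^ 2)) +
          ∫⁻ y in {y : E3 | u₂ < ‖y‖ ∧ ‖y‖ ≤ u₂ * 2 ^ 7}, ENNReal.ofReal (‖fderiv ℝ φ y‖ ^ 2)) := by
  set β : ℝ≥0∞ := volume (ball (0 : E3) 1) with hβ
  set E₁ : ℝ≥0∞ := ∫⁻ y in {y : E3 | u₁ < ‖y‖ ∧ ‖y‖ ≤ u₁ * 2 ^ 7},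
    ENNReal.ofReal (‖fderiv ℝ φ y‖ ^ 2) with hE₁
  set E₂ : ℝ≥0∞ := ∫⁻ y in {y : E3 | u₂ < ‖y‖ ∧ ‖y‖ ≤ u₂ * 2 ^ 7},
    ENNReal.ofReal (‖fderiv ℝ φ y‖ ^ 2) with hE₂
  have hint : IntegrableOn f (ball c₁ r₁) volume :=
    (hf1.continuous.continuousOn.integrableOn_compact (isCompact_closedBall c₁ r₁)).mono_set
      ball_subset_closedBall
  have hI0 : volume (ball m (10 * u)) ≠ 0 := (measure_ball_pos volume m (by positivity)).ne'
  have hItop : volume (ball m (10 * u)) ≠ ⊤ := measure_ball_lt_top.ne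
  have hvolI : volume (ball m (10 * u)) = ENNReal.ofReal ((10 * u) ^ 3) * β := by
    rw [Measure.addHaar_ball_of_pos volume m (by positivity : 0 < 10 * u),
      finrank_euclideanSpace_fin]
  have h1 := enorm_setAverage_sub_setAverage_sq_le hI0 hItop hI₁ hI₂ hint
  have hd₁ := dev_ball_le hf1 hDf hu₁ hr₁ hs₁
  have hd₂ := dev_ball_le hf1 hDf hu₂ hr₂ hs₂
  have hr78 : ∀ {r : ℝ}, 0 < r → r ≤ 78 * u →
      ENNReal.ofReal (4 * r ^ 2) ≤ ENNReal.ofReal (4 * (78 * u) ^ 2) :=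
    fun hr hru => ENNReal.ofReal_le_ofReal (by gcongr)
  -- the scalar identity `u · 2 · (10³ u³ β)⁻¹ · 8 · 4 (78u)² = 16 · (4·78²/10³) · β⁻¹`
  have hscal : ENNReal.ofReal u * (2 * (ENNReal.ofReal ((10 * u) ^ 3) * β)⁻¹ *
      (8 * ENNReal.ofReal (4 * (78 * u) ^ 2))) =
      16 * ENNReal.ofReal (4 * 78 ^ 2 / 10 ^ 3) * β⁻¹ := by
    rw [ENNReal.mul_inv (Or.inr measure_ball_lt_top.ne) (Or.inl ENNReal.ofReal_ne_top),
      ← ENNReal.ofReal_inv_of_pos (by positivity)]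
    have h3 : ENNReal.ofReal u * ENNReal.ofReal ((10 * u) ^ 3)⁻¹ *
        ENNReal.ofReal (4 * (78 * u) ^ 2) = ENNReal.ofReal (4 * 78 ^ 2 / 10 ^ 3) := by
      rw [← ENNReal.ofReal_mul hu.le, ← ENNReal.ofReal_mul (by positivity)]
      congr 1
      field_simp
    calc ENNReal.ofReal u * (2 * (ENNReal.ofReal ((10 * u) ^ 3)⁻¹ * β⁻¹) *
          (8 * ENNReal.ofReal (4 * (78 * u) ^ 2)))
        = 2 * 8 * (ENNReal.ofReal u * ENNReal.ofReal ((10 * u) ^ 3)⁻¹ *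
            ENNReal.ofReal (4 * (78 * u) ^ 2)) * β⁻¹ := by ring
      _ = _ := by rw [h3]; norm_num
  calc ENNReal.ofReal u * ‖(⨍ y in ball c₁ r₁, f y) - ⨍ y in ball c₂ r₂, f y‖ₑ ^ 2
      ≤ ENNReal.ofReal u * (2 * (volume (ball m (10 * u)))⁻¹ *
          (8 * ENNReal.ofReal (4 * r₁ ^ 2) * E₁ + 8 * ENNReal.ofReal (4 * r₂ ^ 2) * E₂)) := by
        refine mul_le_mul_right (h1.trans ?_) _
        exact mul_le_mul_right (add_le_add hd₁ hd₂) _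
    _ ≤ ENNReal.ofReal u * (2 * (volume (ball m (10 * u)))⁻¹ *
          (8 * ENNReal.ofReal (4 * (78 * u) ^ 2) * (E₁ + E₂))) := by
        rw [mul_add (8 * ENNReal.ofReal (4 * (78 * u) ^ 2)) E₁ E₂]
        exact mul_le_mul_right (mul_le_mul_right (add_le_add
          (mul_le_mul_left (mul_le_mul_right (hr78 hr₁ hr₁u) _) _)
          (mul_le_mul_left (mul_le_mul_right (hr78 hr₂ hr₂u) _) _)) _) _
    _ = ENNReal.ofReal u * (2 * (ENNReal.ofReal ((10 * u) ^ 3) * β)⁻¹ *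
          (8 * ENNReal.ofReal (4 * (78 * u) ^ 2))) * (E₁ + E₂) := by rw [hvolI]; ring
    _ = 16 * ENNReal.ofReal (4 * 78 ^ 2 / 10 ^ 3) * β⁻¹ * (E₁ + E₂) := by rw [hscal]

/-- **One ball of the cover.** For a measurable `B ⊆ {u < ‖y‖}` (`u > 0`) on which `φ = f`,
`f` continuous, any constant `c`, and the mean `a_B = ⨍_B f`:
`∫_B (φ − c)²/‖y‖² ≤ u⁻² (2 ∫_B ‖f − a_B‖ₑ² + 2 |B| ‖a_B − c‖ₑ²)`. [folklore] -/
theorem setLIntegral_sq_div_le {f φ : E3 → ℝ} (hfc : Continuous f) {u : ℝ} (hu : 0 < u)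
    {B : Set E3} (hB : MeasurableSet B) (hsub : B ⊆ {y : E3 | u < ‖y‖})
    (hfφ : ∀ y ∈ B, f y = φ y) (c : ℝ) :
    ∫⁻ y in B, ENNReal.ofReal ((φ y - c) ^ 2 / ‖y‖ ^ 2) ≤
      ENNReal.ofReal (u ^ 2)⁻¹ * (2 * (∫⁻ y in B, ‖f y - ⨍ z in B, f z‖ₑ ^ 2) +
        2 * volume B * ‖(⨍ z in B, f z) - c‖ₑ ^ 2) := by
  set a : ℝ := ⨍ z in B, f z with ha
  have hpt : ∀ y ∈ B, ENNReal.ofReal ((φ y - c) ^ 2 / ‖y‖ ^ 2) ≤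
      ENNReal.ofReal (u ^ 2)⁻¹ * (2 * ‖f y - a‖ₑ ^ 2 + 2 * ‖a - c‖ₑ ^ 2) := by
    intro y hy
    have hyu : u < ‖y‖ := hsub hy
    have hy2 : u ^ 2 ≤ ‖y‖ ^ 2 := pow_le_pow_left₀ hu.le hyu.le 2
    have h1 : (φ y - c) ^ 2 / ‖y‖ ^ 2 ≤ (u ^ 2)⁻¹ * (f y - c) ^ 2 := by
      calc (φ y - c) ^ 2 / ‖y‖ ^ 2 = (f y - c) ^ 2 / ‖y‖ ^ 2 := by rw [hfφ y hy]
        _ ≤ (f y - c) ^ 2 / u ^ 2 := div_le_div_of_nonneg_left (sq_nonneg _) (pow_pos hu 2) hy2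
        _ = (u ^ 2)⁻¹ * (f y - c) ^ 2 := by rw [div_eq_mul_inv, mul_comm]
    have h2 : ENNReal.ofReal ((f y - c) ^ 2) = ‖f y - c‖ₑ ^ 2 := by
      rw [Real.enorm_eq_ofReal_abs, ← ENNReal.ofReal_pow (abs_nonneg _), sq_abs]
    have h3 : ‖f y - c‖ₑ ^ 2 ≤ 2 * ‖f y - a‖ₑ ^ 2 + 2 * ‖a - c‖ₑ ^ 2 := by
      calc ‖f y - c‖ₑ ^ 2 = ‖(f y - a) + (a - c)‖ₑ ^ 2 := by rw [sub_add_sub_cancel]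
        _ ≤ (‖f y - a‖ₑ + ‖a - c‖ₑ) ^ 2 := pow_le_pow_left' (enorm_add_le _ _) 2
        _ ≤ _ := Literature.Analysis.FluidPDE.PoincareBall.add_sq_le_two_mul_sq_add _ _
    calc ENNReal.ofReal ((φ y - c) ^ 2 / ‖y‖ ^ 2)
        ≤ ENNReal.ofReal ((u ^ 2)⁻¹ * (f y - c) ^ 2) := ENNReal.ofReal_le_ofReal h1
      _ = ENNReal.ofReal (u ^ 2)⁻¹ * ‖f y - c‖ₑ ^ 2 := by
          rw [ENNReal.ofReal_mul (by positivity), h2]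
      _ ≤ _ := mul_le_mul_right h3 _
  have hmeas : Measurable fun y => 2 * ‖f y - a‖ₑ ^ 2 :=
    (((hfc.sub continuous_const).measurable.enorm).pow_const 2).const_mul 2
  calc ∫⁻ y in B, ENNReal.ofReal ((φ y - c) ^ 2 / ‖y‖ ^ 2)
      ≤ ∫⁻ y in B, ENNReal.ofReal (u ^ 2)⁻¹ * (2 * ‖f y - a‖ₑ ^ 2 + 2 * ‖a - c‖ₑ ^ 2) :=
        setLIntegral_mono' hB hpt
    _ = ENNReal.ofReal (u ^ 2)⁻¹ *
          ((2 * ∫⁻ y in B, ‖f y - a‖ₑ ^ 2) + 2 * ‖a - c‖ₑ ^ 2 * volume B) := by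
        rw [lintegral_const_mul' _ _ ENNReal.ofReal_ne_top, lintegral_add_left hmeas,
          lintegral_const_mul' _ _ ENNReal.ofNat_ne_top, setLIntegral_const]
    _ = _ := by ring

end Summit.FinalStateConjecture.FinalStateConjecture.Cruxes.AdiabaticMultiKerrILED.Sketch.ConstantAtInfinity

namespace Summit.FinalStateConjecture.FinalStateConjecture.Cruxes.AdiabaticMultiKerrILED.Sketch

/-- **Registered sub-goal of `stub_constantAtInfinity` (file `…Balls`)**: the six balls
`B(40u(±eᵢ), 39u)` cover the shell `{10u ≤ ‖y‖ ≤ 20u}` of `ℝ³`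
(`ConstantAtInfinity.exists_mem_ball_of_mem_shell`). [folklore] -/
theorem stub_constantAtInfinity_cover :
    ∀ (u : ℝ), 0 < u → ∀ y : E3, 10 * u ≤ ‖y‖ → ‖y‖ ≤ 20 * u →
      ∃ (i : Fin 3) (b : Bool),
        y ∈ Metric.ball ((40 * u) • EuclideanSpace.single i (if b then (1 : ℝ) else -1)) (39 * u) :=
  fun _ hu _ h1 h2 => ConstantAtInfinity.exists_mem_ball_of_mem_shell hu h1 h2

end Summit.FinalStateConjecture.FinalStateConjecture.Cruxes.AdiabaticMultiKerrILED.Sketch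

end
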